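import Summits.HubbardSuperconductivity.HubbardSuperconductivity.Theses.ComplexGFFStiffness

/-!
# Route `ComplexGFFStiffness` — the Assembly item

The assembly statement `HypACumulant → HypALocalTwoPoint → ComplexGFF4Stiffness` of route
`route-HubbardSuperconductivity-ComplexGFFStiffness` (item stmt-HubbardSuperconductivity-19156) is pure
logic over the tree theorem
`Literature.MathematicalPhysics.StatisticalMechanics.ComplexGradientGFF4.stiffness_tower_of_hypA`
(hypothesis (A) in its two readings — the N-uniform cumulant bound and the N-uniform local two-point
bound — gives volume-uniform stiffness and its sharp form along the tower `n = L^N`, with the Gaussian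
lower bound `CosLowerBoundAt (2/3)` proved in the same Literature file).  Nothing else is used.
-/

namespace Summit.HubbardSuperconductivity.HubbardSuperconductivity.Theorems

set_option linter.dupNamespace false -- summit = problem name (single-conjunct summit), D-0017

open Summit.HubbardSuperconductivity.HubbardSuperconductivity.Theses.ComplexGFFStiffness

/-- **Assembly of route `ComplexGFFStiffness`** (item stmt-HubbardSuperconductivity-19156): the two
readings of hypothesis (A) — `HypACumulant` (N-uniform second-cumulant bound for the tilt response,
with `Z ≠ 0`) and `HypALocalTwoPoint` (N-uniform `O(g)` bound on the nearest-neighbour cosine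
two-point function) — imply the target `ComplexGFF4Stiffness` (volume-uniform stiffness and its
sharp form along the tower of tori of every large odd base).  One-line reduction to
`ComplexGradientGFF4.stiffness_tower_of_hypA`. -/
theorem complexGFFStiffness_assembly_proof : Assembly := by
  unfold Assembly HypACumulant HypALocalTwoPoint ComplexGFF4Stiffness
  exact fun a b =>
    Literature.MathematicalPhysics.StatisticalMechanics.ComplexGradientGFF4.stiffness_tower_of_hypA a b

end Summit.HubbardSuperconductivity.HubbardSuperconductivity.Theorems
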